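import Summits.QuantumFields.QCD.Theses.EulerDescent
import Summits.QuantumFields.YangMills.Theorems.HypercubicLimit.Negative.NonTrivialityBridge
import Literature.MathematicalPhysics.QuantumFieldTheory.SchwingerLimitInheritance

/-!
# `HonestHeavyAnchor` (crux stmt-QuantumFields-16901, route `EulerDescent`) — negative side, BODY clause:
# what non-triviality commits any witness to AT THE LATTICE LEVEL

cdisprove seat `refuter-cdisprove-stmt-QuantumFields-16901-0`, cycle 1 (2026-08-17); work file
`Cruxes/HonestHeavyAnchor/Disproof.lean` §6.  Tree objects only; the species-generic bridge
`twoPointNontrivial_iff_real` (`YangMills/Theorems/HypercubicLimit/Negative/NonTrivialityBridge.lean`) is imported,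
not copied.

* `lattice_truncated_eventually_ne_zero` — `IsQCDAlong sch T` and `T.IsNontrivial s` give real one-point test
  functions `u` (negative times), `v` (positive times) whose TRUNCATED LATTICE two-point value of species `s` is
  non-zero for all large `k` (the clause's complex time-ordered witness is decomposed into four real off-diagonal
  tensors, on which the convergence clause speaks).
* `partition_eventually_ne_zero` — hence the honest `(−1)^F`-twisted partition function
  `∫dμ_W ∫dψ̄dψ e^{−ψ̄D(U,m(k))ψ}` at the scheme's OWN side `2L_k+1`, coupling `β_k`, bare masses `m_f(k)` is non-zero
  for all large `k` (a zero denominator makes every lattice Schwinger function of that step the junk value `0`);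
  `z_eventually_ne_zero` — and `z_s(k) ≠ 0` eventually.
* `witness_partition_eventually_ne_zero`, `witness_z_eventually_ne_zero` — for the crux: any witness has, at
  EVERY heavy tuple, an eventually non-zero twisted partition function at `(β_k, 2L_k+1, m_crit(k) + a_k m_f/Z_m(k))`
  and eventually non-zero `z` for the glue and every flavour-changing pseudoscalar.  Teeth: the witness's bare
  masses follow the corner `sup NonMassive(β_k)` (lattice-unit pin, `Negative/CornerSide.lean`), expected negative
  (`κ_c > 1/8`), where `∏_f det D_W` is real but not configuration-wise positive
  (`Literature.Barriers.QuantumFields.WilsonDeterminantSign`): for `N_f = 3` (or mass-split `N_f = 2`) a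
  sign-problem statement — the `≠ 0` shadow of `stub_honestPartitionPos` (line `block-away-the-sign` of crux
  `SpectralDefectExtinction.ExtinctionBuildsQCD`, which proves `> 0` under an extinction hypothesis). [folklore]
-/

noncomputable section

namespace Summit.QuantumFields.QCD.Theorems.HonestHeavyAnchor.Negative

open scoped SchwartzMap
open MeasureTheory Filter Topology
open Literature.MathematicalPhysics.AQFT Literature.MathematicalPhysics.QuantumLattice
open Literature.MathematicalPhysics.QuantumFieldTheory
open Summit.QuantumFields.YangMills.Theorems.HypercubicLimit.Negative
  (tensor₁ tensor₂ isTensorOf_tensor₁ isTensorOf_tensor₂ isOffDiagonal_of_halfSpaces twoPointNontrivial_iff_real)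
open Summit.QuantumFields.QCD.Theses.EulerDescent (HonestHeavyAnchor)

variable {Nf : ℕ}

/-- **Non-triviality commits the witness at the lattice level**: if `T` is the limit of the scheme `sch`
(`IsQCDAlong sch T`) and the species `s` is non-trivial in `T`, then for some real one-point test functions `u`
(negative times) and `v` (positive times) the TRUNCATED LATTICE two-point value
`⟨Φ^s(u) Φ^s(v)⟩_k − ⟨Φ^s(u)⟩_k ⟨Φ^s(v)⟩_k` is non-zero for all large `k` (bridge `twoPointNontrivial_iff_real` of
the YM negative file + the convergence clause on the real off-diagonal tensors `u ⊗ v`, `u`, `v`). [folklore] -/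
theorem lattice_truncated_eventually_ne_zero (sch : QCDScheme Nf) (T : OSData (QCDField Nf) 4) (s : QCDField Nf)
    (hq : IsQCDAlong sch T) (hT : T.IsNontrivial s) :
    ∃ u v : 𝓢(EuclideanSpace ℝ (Fin 4), ℝ),
      ∀ᶠ k in atTop, qcdLatticeSchwinger sch k (1 + 1) (fun _ => s) ![u, v] -
        qcdLatticeSchwinger sch k 1 (fun _ => s) ![u] * qcdLatticeSchwinger sch k 1 (fun _ => s) ![v] ≠ 0 := by
  obtain ⟨u, v, hu, hv, hne⟩ := (twoPointNontrivial_iff_real T.schwinger s).1 hT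
  obtain ⟨-, -, hconv⟩ := hq
  have h2 := hconv (1 + 1) (by norm_num) (fun _ => s) ![u, v] (tensor₂ u v) (isTensorOf_tensor₂ u v)
    (isOffDiagonal_of_halfSpaces hu hv (isTensorOf_tensor₂ u v))
  have h1u := hconv 1 one_ne_zero (fun _ => s) ![u] (tensor₁ u) (isTensorOf_tensor₁ u)
    (isOffDiagonal_of_subsingleton _)
  have h1v := hconv 1 one_ne_zero (fun _ => s) ![v] (tensor₁ v) (isTensorOf_tensor₁ v)
    (isOffDiagonal_of_subsingleton _)
  exact ⟨u, v, (h2.sub (h1u.mul h1v)).eventually_ne (sub_ne_zero.2 hne)⟩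

/-- Hence **the honest `(−1)^F`-twisted partition function at the scheme's own side `2L_k+1`, coupling `β_k` and bare
masses `m_f(k)` is NON-ZERO for all large `k`** — a zero denominator makes every lattice Schwinger function of step
`k` the junk value `0`, hence the truncated value `0`. [folklore] -/
theorem partition_eventually_ne_zero (sch : QCDScheme Nf) (T : OSData (QCDField Nf) 4) (s : QCDField Nf)
    (hq : IsQCDAlong sch T) (hT : T.IsNontrivial s) :
    ∀ᶠ k in atTop,
      (∫ U, fermiIntegral (fermiBoltzmann U fun fl => sch.mq fl k) ∂(qcdGaugeMeasure sch k)) ≠ 0 := by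
  obtain ⟨u, v, h⟩ := lattice_truncated_eventually_ne_zero sch T s hq hT
  filter_upwards [h] with k hk
  intro hZ
  apply hk
  simp [qcdLatticeSchwinger, hZ]

/-- … and **the multiplicative renormalisation `z_s(k)` of a non-trivial species is eventually non-zero**
(with `z_s(k) = 0` every insertion of species `s` at step `k` vanishes). [folklore] -/
theorem z_eventually_ne_zero (sch : QCDScheme Nf) (T : OSData (QCDField Nf) 4) (s : QCDField Nf)
    (hq : IsQCDAlong sch T) (hT : T.IsNontrivial s) : ∀ᶠ k in atTop, sch.z s k ≠ 0 := by
  obtain ⟨u, v, h⟩ := lattice_truncated_eventually_ne_zero sch T s hq hT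
  filter_upwards [h] with k hk
  intro hz
  apply hk
  simp [qcdLatticeSchwinger, smearedInsertion, List.ofFn_succ, hz]

/-- **Body-side commitment of any witness of the crux**: at EVERY heavy tuple `m` (all `m_f ≥ M_h`) the honest
twisted partition function `∫dμ_W(U) ∫dψ̄dψ e^{−ψ̄ D(U, m(k)) ψ}` on the torus of side `2L_k+1` at coupling `β_k` and
bare masses `m_f(k) = m_crit(k) + a_k m_f/Z_m(k)` is non-zero for all large `k` (it reads neither `z` nor `shift`).
Since `m_crit(k) − mc(k) → 0` with `mc(k) = sup NonMassive(β_k)` expected `< 0` (`κ_c > 1/8`), the bare masses of a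
witness are eventually NEGATIVE, where `∏_f det D_W(U, m_f(k))` is real but NOT configuration-wise positive
(`Literature.Barriers.QuantumFields.WilsonDeterminantSign`): for `N_f = 3`, or `N_f = 2` with `m_u ≠ m_d`, this is a
genuine (sign-problem) statement — cf. `stub_honestPartitionPos` of line `block-away-the-sign`
(crux `SpectralDefectExtinction.ExtinctionBuildsQCD`), which sets out to PROVE positivity. [folklore] -/
theorem witness_partition_eventually_ne_zero (h : HonestHeavyAnchor) (hNf : Nf = 2 ∨ Nf = 3) :
    ∃ (reg : QCDRegularisation Nf) (Mh : ℝ), 0 < Mh ∧ ∀ m : Fin Nf → ℝ, (∀ f, Mh ≤ m f) →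
      ∀ᶠ k in atTop,
        (∫ U, fermiIntegral (fermiBoltzmann U fun fl => (reg.scheme m 0 0).mq fl k)
          ∂(qcdGaugeMeasure (reg.scheme m 0 0) k)) ≠ 0 := by
  obtain ⟨reg, -, Mh, -, -, -, -, -, hMh, hbody⟩ := h Nf hNf
  refine ⟨reg, Mh, hMh, fun m hm => ?_⟩
  obtain ⟨z, shift, T, hq, hN, -⟩ := hbody m hm
  exact partition_eventually_ne_zero (reg.scheme m z shift) T QCDField.glue hq hN

/-- Likewise every witness renormalises the glue and every flavour-changing pseudoscalar by eventually NON-ZERO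
factors `z_s(k)`. [folklore] -/
theorem witness_z_eventually_ne_zero (h : HonestHeavyAnchor) (hNf : Nf = 2 ∨ Nf = 3) :
    ∃ (reg : QCDRegularisation Nf) (Mh : ℝ), 0 < Mh ∧ ∀ m : Fin Nf → ℝ, (∀ f, Mh ≤ m f) →
      ∃ (z shift : QCDField Nf → ℕ → ℝ) (T : OSData (QCDField Nf) 4), IsQCDAlong (reg.scheme m z shift) T ∧
        (∀ᶠ k in atTop, z QCDField.glue k ≠ 0) ∧
          ∀ f g : Fin Nf, f ≠ g → ∀ᶠ k in atTop, z (QCDField.pseudoRe f g) k ≠ 0 := by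
  obtain ⟨reg, -, Mh, -, -, -, -, -, hMh, hbody⟩ := h Nf hNf
  refine ⟨reg, Mh, hMh, fun m hm => ?_⟩
  obtain ⟨z, shift, T, hq, hN, -, hP, -⟩ := hbody m hm
  exact ⟨z, shift, T, hq, z_eventually_ne_zero (reg.scheme m z shift) T _ hq hN,
    fun f g hfg => z_eventually_ne_zero (reg.scheme m z shift) T _ hq (hP f g hfg)⟩

end Summit.QuantumFields.QCD.Theorems.HonestHeavyAnchor.Negative

end
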